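import Summits.HubbardSuperconductivity.HubbardSuperconductivity.Theorems.AnisotropyChordConcavityOneMagnonCoordinates

/-!
# Route `AnisotropyChord`: the one-magnon sector of a connected REGULAR graph — the condensate of every
# sector ground state is `2|V| − 2`, at every anisotropy (positive instance of the monotone-transport
# conjectures U_reg ⊇ U_vt ⊇ M_Δ in their first sector; bears on `stub_monotoneFM` of `FerroSideChord`
# stmt-19089 and on `Concavity` stmt-8150)

For a finite connected `k`-regular simple graph `G` the one-magnon block of
`H(Δ) = xxzHamiltonian 1 G (−1) Δ` is `−½A + const·1` (`…OneMagnonSector`), so "the Perron vector does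
not move with `Δ`".  Made quantitative WITHOUT Perron–Frobenius: for EVERY normalised ground state `ψ`
of the sector `S^z_tot = |V|/2 − 1`, at every `Δ`,

  `Λ(ψ) = Re⟨ψ, S⁺_tot S⁻_tot ψ⟩ = 2|V| − 2`            (`oneMagnon_condensate_eq_of_regular`),

because the variational principle with the flat test vector forces the Dirichlet form
`Σ_{i∼j} |v_i − v_j|²` of the amplitudes to vanish, hence (connectedness) all amplitudes are equal and the
zero-mode weight `|Σ_i v_i|²` equals `|V|`.  Consequently the condensate is (trivially) monotone and
concave in `Δ` in this sector on every connected regular graph (`oneMagnon_condensate_monotone_of_regular`)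
— in contrast with the non-regular two-hub graph `W₁₃` of `…OneMagnonDip`, where it drops.  The theory
seat's remark "N = 1: trivial on regular graphs" (hubbard-h0-rotor-theory-1, cycle 3, §18), kernel-checked.
No definition is introduced.
-/

set_option linter.dupNamespace false

noncomputable section

namespace Summit.HubbardSuperconductivity.HubbardSuperconductivity.Theorems.AnisotropyChord.OneMagnon

open Matrix Complex Finset
open Literature.MathematicalPhysics.QuantumLattice

variable {V : Type*} [Fintype V] [DecidableEq V] (G : SimpleGraph V) [DecidableRel G.Adj]

omit [DecidableEq V] in
/-- On a graph, `Σ_j [i ∼ j] = d_i` (as a real number). [folklore] -/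
theorem sum_ite_adj_one (i : V) : (∑ j, (if G.Adj i j then (1 : ℝ) else 0)) = (G.degree i : ℝ) := by
  rw [Finset.sum_boole, ← SimpleGraph.card_neighborFinset_eq_degree, SimpleGraph.neighborFinset_eq_filter]

omit [DecidableEq V] in
/-- `Σ_j [i ∼ j]·c = d_i·c`. [folklore] -/
theorem sum_ite_adj_const (i : V) (c : ℝ) :
    (∑ j, (if G.Adj i j then c else 0)) = (G.degree i : ℝ) * c := by
  have h : ∀ j, (if G.Adj i j then c else 0) = (if G.Adj i j then (1 : ℝ) else 0) * c := fun j => by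
    split_ifs <;> simp
  rw [Finset.sum_congr rfl (fun j _ => h j), ← Finset.sum_mul, sum_ite_adj_one]

/-- **One-magnon sector of a connected regular graph: the condensate of every sector ground state is
`2|V| − 2`, at every anisotropy.**  For a finite connected `k`-regular simple graph and any real `Δ`,
every normalised ground state `ψ` of the sector `S^z_tot = |V|/2 − 1` of `xxzHamiltonian 1 G (−1) Δ`
has `Re⟨ψ, S⁺_tot S⁻_tot ψ⟩ = 2|V| − 2` (all one-magnon amplitudes are equal: the flat test vector and
the vanishing of the Dirichlet form; no Perron–Frobenius). [folklore] -/
theorem oneMagnon_condensate_eq_of_regular (hconn : G.Connected) {k : ℕ} (hreg : G.IsRegularOfDegree k)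
    (Δ : ℝ) (ψ : (V → Fin 2) → ℂ)
    (hmem : ψ ∈ spinZSector (Λ := V) 1 ((Fintype.card V : ℝ) / 2 - 1)) (hnorm : star ψ ⬝ᵥ ψ = 1)
    (heig : (xxzHamiltonian 1 G (-1) Δ : Op V 2) *ᵥ ψ =
      ((lowestEnergyInSector 1 (xxzHamiltonian 1 G (-1) Δ) ((Fintype.card V : ℝ) / 2 - 1) : ℝ) : ℂ) • ψ) :
    (star ψ ⬝ᵥ (((∑ x, onSite x (spinRaise 1)) * (∑ y, onSite y (spinLower 1)) : Op V 2) *ᵥ ψ)).re =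
      2 * (Fintype.card V : ℝ) - 2 := by
  haveI : Nonempty V := hconn.nonempty
  have hsupp := apply_eq_zero_of_mem_oneMagnonSector hmem
  have hdeg : ∀ i, (G.degree i : ℝ) = k := fun i => by rw [hreg.degree_eq i]
  -- abbreviations for the amplitudes
  set a : V → ℝ := fun i => (ψ (Pi.single i 1)).re with ha
  set b : V → ℝ := fun i => (ψ (Pi.single i 1)).im with hb
  -- norm
  have hN : (star ψ ⬝ᵥ ψ).re = 1 := by rw [hnorm, Complex.one_re]
  have hN' : ∑ i, (a i ^ 2 + b i ^ 2) = 1 := by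
    have h := hN
    rw [re_norm_eq hsupp] at h
    exact h
  -- energy of the ground state: c · 1 − ½ P = E
  have hE := re_energy_of_eigen hnorm heig
  rw [re_energy_eq G Δ hsupp] at hE
  simp only [hdeg] at hE
  rw [Finset.sum_sub_distrib, ← Finset.mul_sum, ← Finset.mul_sum] at hE
  change -(Δ * ((G.edgeFinset.card : ℝ) / 4 - (k : ℝ) / 2)) * ∑ i, (a i ^ 2 + b i ^ 2) -
    1 / 2 * ∑ i, ∑ j, (if G.Adj i j then a i * a j + b i * b j else 0) = _ at hE
  rw [hN', mul_one] at hE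
  -- variational principle with the flat test vector: E · |V| ≤ |V|·c − ½ |V| k
  have hV := energy_le_test G Δ (fun _ => (1 : ℝ))
  simp only [one_pow, mul_one, Finset.sum_const, Finset.card_univ, nsmul_eq_mul, hdeg] at hV
  rw [show (∑ i : V, (-(Δ * ((G.edgeFinset.card : ℝ) / 4 - (k : ℝ) / 2)) -
      1 / 2 * ∑ j, (if G.Adj i j then (1 : ℝ) else 0))) =
      (Fintype.card V : ℝ) * (-(Δ * ((G.edgeFinset.card : ℝ) / 4 - (k : ℝ) / 2)) - 1 / 2 * k) by
    rw [Finset.sum_congr rfl (fun i _ => by rw [sum_ite_adj_one, hdeg i]), Finset.sum_const,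
      Finset.card_univ, nsmul_eq_mul]] at hV
  have hn : (0 : ℝ) < Fintype.card V := by exact_mod_cast Fintype.card_pos
  -- hence the pair sum P is at least k
  have hP : (k : ℝ) ≤ ∑ i, ∑ j, (if G.Adj i j then a i * a j + b i * b j else 0) := by
    nlinarith
  -- the Dirichlet form Σ_i Σ_j [i∼j]((a_i−a_j)² + (b_i−b_j)²) = 2k − 2P ≤ 0
  have hS1 : ∑ i, ∑ j, (if G.Adj i j then (a i ^ 2 + b i ^ 2) else 0) = k := by
    rw [Finset.sum_congr rfl (fun i _ => sum_ite_adj_const G i (a i ^ 2 + b i ^ 2))]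
    simp only [hdeg]
    rw [← Finset.mul_sum, hN', mul_one]
  have hS2 : ∑ i, ∑ j, (if G.Adj i j then (a j ^ 2 + b j ^ 2) else 0) = k := by
    rw [Finset.sum_comm]
    have h : ∀ i j : V, (if G.Adj j i then (a i ^ 2 + b i ^ 2) else 0) =
        (if G.Adj i j then (a i ^ 2 + b i ^ 2) else (0 : ℝ)) := fun i j => by
      simp only [G.adj_comm]
    rw [Finset.sum_congr rfl (fun i _ => Finset.sum_congr rfl (fun j _ => h i j))]
    exact hS1
  have hD : ∑ i, ∑ j, (if G.Adj i j then ((a i - a j) ^ 2 + (b i - b j) ^ 2) else 0) =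
      2 * k - 2 * ∑ i, ∑ j, (if G.Adj i j then a i * a j + b i * b j else 0) := by
    have h : ∀ i j : V, (if G.Adj i j then ((a i - a j) ^ 2 + (b i - b j) ^ 2) else (0 : ℝ)) =
        (if G.Adj i j then (a i ^ 2 + b i ^ 2) else 0) + (if G.Adj i j then (a j ^ 2 + b j ^ 2) else 0)
          - 2 * (if G.Adj i j then a i * a j + b i * b j else 0) := fun i j => by
      split_ifs <;> ring
    rw [Finset.sum_congr rfl (fun i _ => Finset.sum_congr rfl (fun j _ => h i j))]
    simp only [Finset.sum_sub_distrib, Finset.sum_add_distrib, ← Finset.mul_sum]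
    rw [hS1, hS2]
    ring
  have hDle : ∑ i, ∑ j, (if G.Adj i j then ((a i - a j) ^ 2 + (b i - b j) ^ 2) else 0) ≤ 0 := by
    rw [hD]; linarith
  have hterm_nonneg : ∀ i j : V, 0 ≤ (if G.Adj i j then ((a i - a j) ^ 2 + (b i - b j) ^ 2) else (0 : ℝ)) :=
    fun i j => by split_ifs <;> positivity
  -- every edge term vanishes: amplitudes agree along edges
  have hedge : ∀ u v : V, G.Adj u v → a u = a v ∧ b u = b v := by
    intro u v huv
    have h1 : (if G.Adj u v then ((a u - a v) ^ 2 + (b u - b v) ^ 2) else (0 : ℝ)) ≤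
        ∑ j, (if G.Adj u j then ((a u - a j) ^ 2 + (b u - b j) ^ 2) else 0) :=
      Finset.single_le_sum (f := fun j => (if G.Adj u j then ((a u - a j) ^ 2 + (b u - b j) ^ 2) else (0 : ℝ)))
        (fun j _ => hterm_nonneg u j) (Finset.mem_univ v)
    have h2 : (∑ j, (if G.Adj u j then ((a u - a j) ^ 2 + (b u - b j) ^ 2) else (0 : ℝ))) ≤
        ∑ i, ∑ j, (if G.Adj i j then ((a i - a j) ^ 2 + (b i - b j) ^ 2) else 0) :=
      Finset.single_le_sum (f := fun i => ∑ j, (if G.Adj i j then ((a i - a j) ^ 2 + (b i - b j) ^ 2) else (0 : ℝ)))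
        (fun i _ => Finset.sum_nonneg fun j _ => hterm_nonneg i j) (Finset.mem_univ u)
    rw [if_pos huv] at h1
    have hsq : (a u - a v) ^ 2 + (b u - b v) ^ 2 = 0 := by
      have := sq_nonneg (a u - a v); have := sq_nonneg (b u - b v); linarith
    have ha0 : (a u - a v) ^ 2 = 0 := by nlinarith [sq_nonneg (a u - a v), sq_nonneg (b u - b v)]
    have hb0 : (b u - b v) ^ 2 = 0 := by nlinarith [sq_nonneg (a u - a v), sq_nonneg (b u - b v)]
    exact ⟨by simpa [sub_eq_zero] using pow_eq_zero_iff (two_ne_zero) |>.mp ha0,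
      by simpa [sub_eq_zero] using pow_eq_zero_iff (two_ne_zero) |>.mp hb0⟩
  -- connectedness: all amplitudes equal
  obtain ⟨i₀⟩ := ‹Nonempty V›
  have hconst : ∀ i, a i = a i₀ ∧ b i = b i₀ := by
    intro i
    obtain ⟨p⟩ := hconn.preconnected i i₀
    induction p with
    | nil => exact ⟨rfl, rfl⟩
    | cons h _ ih => exact ⟨(hedge _ _ h).1.trans ih.1, (hedge _ _ h).2.trans ih.2⟩
  -- conclude
  rw [condensate_eq hmem, hN]
  change (∑ i, a i) ^ 2 + (∑ i, b i) ^ 2 + 2 * ((Fintype.card V : ℝ) / 2 - 1) * 1 = _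
  rw [Finset.sum_congr rfl (fun i _ => (hconst i).1), Finset.sum_congr rfl (fun i _ => (hconst i).2),
    Finset.sum_const, Finset.sum_const, Finset.card_univ, nsmul_eq_mul, nsmul_eq_mul]
  rw [Finset.sum_congr rfl (fun i _ => show a i ^ 2 + b i ^ 2 = a i₀ ^ 2 + b i₀ ^ 2 by
    rw [(hconst i).1, (hconst i).2]), Finset.sum_const, Finset.card_univ, nsmul_eq_mul] at hN'
  nlinarith [hN']

/-- **Corollary: in the one-magnon sector of a connected regular graph the condensate is monotone
(indeed constant) in the anisotropy** — the first-sector instance of the conjectures U_reg ⊇ U_vt ⊇ M_Δ,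
on every connected regular graph and for all real `Δ₁, Δ₂`. [folklore] -/
theorem oneMagnon_condensate_monotone_of_regular (hconn : G.Connected) {k : ℕ}
    (hreg : G.IsRegularOfDegree k) (Δ₁ Δ₂ : ℝ) (ψ₁ ψ₂ : (V → Fin 2) → ℂ)
    (h1m : ψ₁ ∈ spinZSector (Λ := V) 1 ((Fintype.card V : ℝ) / 2 - 1)) (h1n : star ψ₁ ⬝ᵥ ψ₁ = 1)
    (h1e : (xxzHamiltonian 1 G (-1) Δ₁ : Op V 2) *ᵥ ψ₁ =
      ((lowestEnergyInSector 1 (xxzHamiltonian 1 G (-1) Δ₁) ((Fintype.card V : ℝ) / 2 - 1) : ℝ) : ℂ) • ψ₁)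
    (h2m : ψ₂ ∈ spinZSector (Λ := V) 1 ((Fintype.card V : ℝ) / 2 - 1)) (h2n : star ψ₂ ⬝ᵥ ψ₂ = 1)
    (h2e : (xxzHamiltonian 1 G (-1) Δ₂ : Op V 2) *ᵥ ψ₂ =
      ((lowestEnergyInSector 1 (xxzHamiltonian 1 G (-1) Δ₂) ((Fintype.card V : ℝ) / 2 - 1) : ℝ) : ℂ) • ψ₂) :
    (star ψ₁ ⬝ᵥ (((∑ x, onSite x (spinRaise 1)) * (∑ y, onSite y (spinLower 1)) : Op V 2) *ᵥ ψ₁)).re ≤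
      (star ψ₂ ⬝ᵥ (((∑ x, onSite x (spinRaise 1)) * (∑ y, onSite y (spinLower 1)) : Op V 2) *ᵥ ψ₂)).re := by
  rw [oneMagnon_condensate_eq_of_regular G hconn hreg Δ₁ ψ₁ h1m h1n h1e,
    oneMagnon_condensate_eq_of_regular G hconn hreg Δ₂ ψ₂ h2m h2n h2e]

end Summit.HubbardSuperconductivity.HubbardSuperconductivity.Theorems.AnisotropyChord.OneMagnon
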